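import Summits.BirchSwinnertonDyer.BirchSwinnertonDyer.Theorems.KolyvaginDepthDoorDepthTableIntrinsic
import Summits.BirchSwinnertonDyer.BirchSwinnertonDyer.Theorems.KolyvaginDepthDoorKNSupplyExactReading
import HarnessLib

/-!
# Route `KolyvaginDepthDoor`, crux `KolyvaginDepthSupplyKN` (stmt-BirchSwinnertonDyer-22820) —
# DEPTH TABLE v16, GENERIC: THE INTRINSIC EVEN-RANK ROW ON THE SPLIT CELL (Castella–Sano supply, no ♠) —
# `p`- and `K`-uniform, the twist model enters ONLY through its datum

Helper file of the lead prover of line `levelone` (kdd-p1 g20; `--supports stmt-BirchSwinnertonDyer-22820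
--as helper`); it closes nothing and BSD is NOT proved by it.

Companion of `KolyvaginDepthDoorDepthTableIntrinsic` (♠ supply). The rows `664a1`, `707a1`, `916c1`, `944e1` (and every rank-two curve
at a prime `p` SPLIT in the Heegner field) take their mod-`p` structure statement from Castella–Sano 2026 Thm. 3 ∘ Zanarella 2019 Prop.
2.18 ∘ Howard–Zanarella on the `p ∤ c_φ` frame (modularity + Mazur 1978 Cor. 4.1; Néron scaling is a tree theorem) — g14's
`exists_kolyvaginClass_one_selmerCard_dichotomy_of_maninPrint` — instead of W. Zhang's Lemma 8.4 (1); no ♠ hypothesis, any conductor,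
but `d_K` odd and `p` split in `K`. Until now this supply existed only per curve at the prime of record (`C<label>.cruxBody_of_twistSelmer`,
`p = 5`). This file makes it GENERIC and uniform in `(p, K)`:

* `cruxBody_of_sha_of_twistSelmer_of_castellaSano` — the split-cell analogue of g17's `cruxBody_of_sha_of_twistSelmer_of_lemma84`:
  `Ш(E)[p] = 0` + `#Sel_p(E^{(d_K)}) ≤ p^{rank E}` ⟹ the clause of `KolyvaginDepthSupplyKN` at `W` (first disjunct of the twist
  condition in `rankClause_of_structure_of_twistCondition`).
* `cruxBody_of_twistSelmer_of_steinWuthrich_split` — with `Ш(E)[p] = 0` from Stein–Wuthrich 2013 Thm. 1.1 by name (`N_E ≤ 30 000`).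
* `cruxBody_of_twistBSDQuotient_intrinsic_split` — THE INTRINSIC EVEN-RANK MECHANISM ON THE SPLIT CELL: `T` ANY globally minimal model
  of `E^{(d_K)}`, NO arithmetic hypothesis on it; IF `ord_{s=1} L(E^{(d_K)}, s) = 1` and `ord_p(L'(T,1)/(Ω_T Reg_T)) ≤ k`, `k + 1 ≤ rank W`,
  THEN the clause holds at `W` VERBATIM (twist bound `natCard_selmerGroup_quadraticTwist_le_of_bsdQuotient_intrinsic` of the companion file).

CONDITIONAL on Stein–Wuthrich 2013 Thm. 1.1, Castella–Sano 2026 Thm. 3, Zanarella 2019 Prop. 2.18, Howard–Zanarella, modularity,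
Mazur 1978 Cor. 4.1, Burungale–Castella–Skinner 2025 Cor. 1.3.1 and GZK, BY NAME; per `(W, p, K)`; nothing class-wide on the open stub
(S♭); BSD is NOT proved by any of this.

References: [CastellaSano2026] Thm. 3 (arXiv:2601.14504 §1.1.6); [Zanarella2019] Prop. 2.18, Cor. 2.14; [Howard2004] Lemma 1.6.4;
[Mazur1978] Cor. 4.1; [SteinWuthrich2013] Thm. 1.1 (p. 1758); [BurungaleCastellaSkinner2025] Cor. 1.3.1 (p. 4); [Darmon2004] Thm. 3.22;
[SilvermanAEC2009] X.4.2.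
-/

set_option linter.dupNamespace false

noncomputable section

open scoped Classical NumberField

namespace Summit.BirchSwinnertonDyer.BirchSwinnertonDyer.Theorems.KolyvaginDepthDoor

open Literature.NumberTheory.EllipticCurves Literature.NumberTheory.EllipticCurves.ModularForms
  WeierstrassCurve NumberField IsDedekindDomain
open Summit.BirchSwinnertonDyer.BirchSwinnertonDyer.Theorems

/-! ## The split cell (Castella–Sano supply): generic clause, `p`- and `K`-uniform -/

/-- **The clause of `KolyvaginDepthSupplyKN` at ONE curve from `Ш(E/ℚ)[p] = 0` and ONE twist `p`-Selmer bound — SPLIT supply,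
generic** (the Castella–Sano analogue of g17's `cruxBody_of_sha_of_twistSelmer_of_lemma84`; no ♠, any conductor). `W` globally minimal,
`2 ≤ rank_ℤ E(ℚ)`; `p ≥ 5` good ordinary with `ρ_{E,p^n}` onto for all `n` and `p ∤ ord_v(Δ_min)` at multiplicative `v`; `K` imaginary
quadratic Heegner for `N_E` with `d_K` odd, `∉ {−3,−4}`, `p ∤ d_K`, `p` SPLIT in `K`. IF `Ш(E/ℚ)[p] = 0` and `#Sel_p(E^{(d_K)}/ℚ) ≤
p ^ rank_ℤ E(ℚ)`, THEN the crux's clause holds at `W` verbatim: the full mod-`p` structure statement on the `p ∤ c_φ` frame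
(`exists_kolyvaginClass_one_selmerCard_dichotomy_of_maninPrint`: Castella–Sano Thm. 3, Zanarella 2.18, Howard–Zanarella, modularity,
Mazur BY NAME) and `rankClause_of_structure_of_twistCondition` (first disjunct of the twist condition). CONDITIONAL on the five named
facts; per `(E, p, K)`; BSD is not proved by it. [cite: CastellaSano2026, Thm. 3 (arXiv:2601.14504 §1.1.6)]
[cite: Zanarella2019, Prop. 2.18, Cor. 2.14] [cite: Howard2004, Lemma 1.6.4] [cite: Mazur1978, Cor. 4.1] -/
theorem cruxBody_of_sha_of_twistSelmer_of_castellaSano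
    (h3 : Literature.NumberTheory.EllipticCurves.CastellaSano2026_kolyvaginClass_selmerDivisibility_eq_padicValNat_tamagawaProduct)
    (hZ : Literature.NumberTheory.EllipticCurves.Zanarella2019_kolyvaginClass_one_ne_zero_of_not_selmerDivisible)
    (hHZ : Literature.NumberTheory.EllipticCurves.HowardZanarella_exists_minimal_kolyvaginClass_one_selmerCard_of_ne_zero)
    (hnf : exists_isNewformOf) (hMaz : mazur_not_dvd_maninConstant_of_odd)
    (W : WeierstrassCurve ℚ) [W.IsElliptic] [W.IsGloballyMinimal] (hr : 2 ≤ W.mordellWeilRank)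
    (p : ℕ) [hp : Fact p.Prime] (h5 : 5 ≤ p) (hgood : W.HasGoodReductionAtPrime p)
    (hord : ¬ (p : ℤ) ∣ W.frobeniusTrace p)
    (htower : ∀ n : ℕ, W.HasSurjectiveModNGaloisRep (p ^ n : ℕ))
    (hKN : ∀ v : HeightOneSpectrum (𝓞 ℚ), W.HasMultiplicativeReductionAt v →
      ¬ p ∣ W.ordMinimalDiscriminant v)
    (K : Type) [Field K] [NumberField K] (hK : IsImaginaryQuadratic K)
    (hodd : Odd (NumberField.discr K)) (hD3 : NumberField.discr K ≠ -3) (hD4 : NumberField.discr K ≠ -4)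
    (hpD : ¬ ((p : ℤ) ∣ NumberField.discr K)) (hspl : SatisfiesHeegnerHypothesis p K)
    [iNZ : NeZero (W.conductorNorm ℤ)] (hH : SatisfiesHeegnerHypothesis (W.conductorNorm ℤ) K)
    (hsha : (W.sha ⊓ AddSubgroup.torsionBy W.galH1 (p : ℤ) : AddSubgroup W.galH1) = ⊥)
    (hT : Nat.card ((W.quadraticTwist (NumberField.discr K : ℚ)).selmerGroup p) ≤ p ^ W.mordellWeilRank) :
    ∃ (p : ℕ) (hp : Fact p.Prime), 5 ≤ p ∧ W.HasGoodReductionAtPrime p ∧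
      ¬ (p : ℤ) ∣ W.frobeniusTrace p ∧ (∀ n : ℕ, W.HasSurjectiveModNGaloisRep (p ^ n : ℕ)) ∧
      (∀ v : HeightOneSpectrum (𝓞 ℚ), W.HasMultiplicativeReductionAt v →
        ¬ p ∣ W.ordMinimalDiscriminant v) ∧
      ∃ (K : Type) (_ : Field K) (_ : NumberField K), IsImaginaryQuadratic K ∧
        NumberField.discr K ≠ -3 ∧ NumberField.discr K ≠ -4 ∧
        ∃ (_ : NeZero (W.conductorNorm ℤ)), SatisfiesHeegnerHypothesis (W.conductorNorm ℤ) K ∧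
        ∃ (Dt : ModularParametrizationData W (W.conductorNorm ℤ)) (β : ℤ) (ι : K →+* ℂ) (n₁ : ℕ)
          (d : KolyvaginHeegnerData Dt β ι n₁), Squarefree n₁ ∧
          (∀ q ∈ n₁.primeFactors, Zhang2014.IsKolyvaginPrime (W.conductorNorm ℤ) W K p q) ∧
          d.kolyvaginClass hp.out 1 ≠ 0 ∧
          (n₁.primeFactors.card + 1 ≤ W.mordellWeilRank ∨
            (n₁.primeFactors.card ≤ W.mordellWeilRank ∧
              n₁.primeFactors.card + 1 ≤ (W.quadraticTwist (NumberField.discr K : ℚ)).mordellWeilRank)) := by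
  have _hr := hr
  have hsur : W.HasSurjectiveModNGaloisRep p := by simpa only [pow_one] using htower 1
  have hstr := exists_kolyvaginClass_one_selmerCard_dichotomy_of_maninPrint h3 hZ hHZ hnf hMaz W p h5
    hgood hord htower hKN K hK hH hodd hD3 hD4 hpD hspl
  obtain ⟨Dt', β', ι', n', d', hsupp', hne', hclause⟩ :=
    rankClause_of_structure_of_twistCondition W p hsur K hstr hsha (Or.inl hT)
  refine ⟨p, hp, h5, hgood, hord, htower, hKN, ?_⟩
  refine ⟨K, ‹Field K›, ‹NumberField K›, ?_⟩
  refine ⟨hK, ?_⟩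
  refine ⟨hD3, ?_⟩
  refine ⟨hD4, ?_⟩
  refine ⟨iNZ, ?_⟩
  refine ⟨hH, ?_⟩
  refine ⟨Dt', β', ι', n', d', ?_⟩
  exact ⟨hsupp'.1, hsupp'.2, hne', hclause⟩

/-- **In the Stein–Wuthrich range, on the SPLIT cell, the clause of `KolyvaginDepthSupplyKN` at a curve is ONE twist `p`-Selmer datum
away** (generic; the split-cell analogue of g17's `cruxBody_of_twistSelmer_of_steinWuthrich`): `Ш(E/ℚ)[p] = 0` is Stein–Wuthrich 2013
Thm. 1.1 by name (`N_E ≤ 30 000`, non-CM, `2 ≤ rank`, `5 ≤ p < 1000` good ordinary, `ρ̄` onto), the rest is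
`cruxBody_of_sha_of_twistSelmer_of_castellaSano`. CONDITIONAL on the six named facts; per `(E, p, K)`; BSD is not proved by it.
[cite: SteinWuthrich2013, Thm. 1.1 (p. 1758)] [cite: CastellaSano2026, Thm. 3] -/
theorem cruxBody_of_twistSelmer_of_steinWuthrich_split
    (hSW : SteinWuthrich2013_sha_inf_torsionBy_eq_bot_of_two_le_rank)
    (h3 : Literature.NumberTheory.EllipticCurves.CastellaSano2026_kolyvaginClass_selmerDivisibility_eq_padicValNat_tamagawaProduct)
    (hZ : Literature.NumberTheory.EllipticCurves.Zanarella2019_kolyvaginClass_one_ne_zero_of_not_selmerDivisible)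
    (hHZ : Literature.NumberTheory.EllipticCurves.HowardZanarella_exists_minimal_kolyvaginClass_one_selmerCard_of_ne_zero)
    (hnf : exists_isNewformOf) (hMaz : mazur_not_dvd_maninConstant_of_odd)
    (W : WeierstrassCurve ℚ) [W.IsElliptic] [W.IsGloballyMinimal] (hcm : ¬ W.HasCM) (hr : 2 ≤ W.mordellWeilRank)
    (hN : W.conductorNorm ℤ ≤ 30000)
    (p : ℕ) [hp : Fact p.Prime] (h5 : 5 ≤ p) (hp1000 : p < 1000) (hgood : W.HasGoodReductionAtPrime p)
    (hord : ¬ (p : ℤ) ∣ W.frobeniusTrace p)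
    (htower : ∀ n : ℕ, W.HasSurjectiveModNGaloisRep (p ^ n : ℕ))
    (hKN : ∀ v : HeightOneSpectrum (𝓞 ℚ), W.HasMultiplicativeReductionAt v →
      ¬ p ∣ W.ordMinimalDiscriminant v)
    (K : Type) [Field K] [NumberField K] (hK : IsImaginaryQuadratic K)
    (hodd : Odd (NumberField.discr K)) (hD3 : NumberField.discr K ≠ -3) (hD4 : NumberField.discr K ≠ -4)
    (hpD : ¬ ((p : ℤ) ∣ NumberField.discr K)) (hspl : SatisfiesHeegnerHypothesis p K)
    [iNZ : NeZero (W.conductorNorm ℤ)] (hH : SatisfiesHeegnerHypothesis (W.conductorNorm ℤ) K)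
    (hT : Nat.card ((W.quadraticTwist (NumberField.discr K : ℚ)).selmerGroup p) ≤ p ^ W.mordellWeilRank) :
    ∃ (p : ℕ) (hp : Fact p.Prime), 5 ≤ p ∧ W.HasGoodReductionAtPrime p ∧
      ¬ (p : ℤ) ∣ W.frobeniusTrace p ∧ (∀ n : ℕ, W.HasSurjectiveModNGaloisRep (p ^ n : ℕ)) ∧
      (∀ v : HeightOneSpectrum (𝓞 ℚ), W.HasMultiplicativeReductionAt v →
        ¬ p ∣ W.ordMinimalDiscriminant v) ∧
      ∃ (K : Type) (_ : Field K) (_ : NumberField K), IsImaginaryQuadratic K ∧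
        NumberField.discr K ≠ -3 ∧ NumberField.discr K ≠ -4 ∧
        ∃ (_ : NeZero (W.conductorNorm ℤ)), SatisfiesHeegnerHypothesis (W.conductorNorm ℤ) K ∧
        ∃ (Dt : ModularParametrizationData W (W.conductorNorm ℤ)) (β : ℤ) (ι : K →+* ℂ) (n₁ : ℕ)
          (d : KolyvaginHeegnerData Dt β ι n₁), Squarefree n₁ ∧
          (∀ q ∈ n₁.primeFactors, Zhang2014.IsKolyvaginPrime (W.conductorNorm ℤ) W K p q) ∧
          d.kolyvaginClass hp.out 1 ≠ 0 ∧
          (n₁.primeFactors.card + 1 ≤ W.mordellWeilRank ∨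
            (n₁.primeFactors.card ≤ W.mordellWeilRank ∧
              n₁.primeFactors.card + 1 ≤ (W.quadraticTwist (NumberField.discr K : ℚ)).mordellWeilRank)) := by
  have hsur : W.HasSurjectiveModNGaloisRep p := by simpa only [pow_one] using htower 1
  have hsha : (W.sha ⊓ AddSubgroup.torsionBy W.galH1 (p : ℤ) : AddSubgroup W.galH1) = ⊥ :=
    hSW W hcm hr hN p h5 hp1000 hgood hord hsur
  exact cruxBody_of_sha_of_twistSelmer_of_castellaSano h3 hZ hHZ hnf hMaz W hr p h5 hgood hord htower hKN K hK hodd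
    hD3 hD4 hpD hspl hH hsha hT

/-- **THE INTRINSIC EVEN-RANK ROW MECHANISM, SPLIT SUPPLY — every Heegner field with odd `d_K`, every admissible SPLIT prime, NO
hypothesis on the twist model, NO ♠** (covers the non-♠ conductors `664a1`, `916c1`, `944e1` and every rank-two curve at a split prime).
`W` globally minimal, non-CM, `2 ≤ rank`, `N_E ≤ 30 000`; `5 ≤ p < 1000` good ordinary, `ρ_{W,p^n}` onto, Kodaira–Néron; `K` imaginary
quadratic Heegner with `d_K` odd, `∉ {−3,−4}`, `p ∤ d_K`, `p` split in `K`; `T` ANY globally minimal model of `E^{(d_K)}`. IF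
`ord_{s=1} L(E^{(d_K)}, s) = 1` and `ord_p(L'(T,1)/(Ω_T·Reg_T)) ≤ k`, `k + 1 ≤ rank W`, THEN the clause of `KolyvaginDepthSupplyKN`
holds at `W` VERBATIM. CONDITIONAL on Stein–Wuthrich Thm. 1.1, Castella–Sano Thm. 3, Zanarella 2.18, Howard–Zanarella, modularity,
Mazur Cor. 4.1, BCS Cor. 1.3.1, GZK by name; per `(W, p, K)`; nothing class-wide; BSD is not proved by it.
[cite: SteinWuthrich2013, Thm. 1.1 (p. 1758)] [cite: CastellaSano2026, Thm. 3] [cite: BurungaleCastellaSkinner2025, Cor. 1.3.1 (p. 4)]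
[cite: Darmon2004, Thm. 3.22] -/
theorem cruxBody_of_twistBSDQuotient_intrinsic_split
    (hSW : SteinWuthrich2013_sha_inf_torsionBy_eq_bot_of_two_le_rank)
    (h3 : Literature.NumberTheory.EllipticCurves.CastellaSano2026_kolyvaginClass_selmerDivisibility_eq_padicValNat_tamagawaProduct)
    (hZ : Literature.NumberTheory.EllipticCurves.Zanarella2019_kolyvaginClass_one_ne_zero_of_not_selmerDivisible)
    (hHZ : Literature.NumberTheory.EllipticCurves.HowardZanarella_exists_minimal_kolyvaginClass_one_selmerCard_of_ne_zero)
    (hnf : exists_isNewformOf) (hMaz : mazur_not_dvd_maninConstant_of_odd)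
    (hBCS : BurungaleCastellaSkinner2025.cor131_padicValRat_bsd_rank_le_one)
    (hGZK : rank_eq_analyticRank_of_analyticRank_le_one)
    (W : WeierstrassCurve ℚ) [W.IsElliptic] [W.IsGloballyMinimal] (hcm : ¬ W.HasCM) (hr : 2 ≤ W.mordellWeilRank)
    (hN : W.conductorNorm ℤ ≤ 30000)
    (p : ℕ) [hp : Fact p.Prime] (h5 : 5 ≤ p) (hp1000 : p < 1000) (hgood : W.HasGoodReductionAtPrime p)
    (hord : ¬ (p : ℤ) ∣ W.frobeniusTrace p)
    (htower : ∀ n : ℕ, W.HasSurjectiveModNGaloisRep (p ^ n : ℕ))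
    (hKN : ∀ v : HeightOneSpectrum (𝓞 ℚ), W.HasMultiplicativeReductionAt v →
      ¬ p ∣ W.ordMinimalDiscriminant v)
    (K : Type) [Field K] [NumberField K] (hK : IsImaginaryQuadratic K)
    (hodd : Odd (NumberField.discr K)) (hD3 : NumberField.discr K ≠ -3) (hD4 : NumberField.discr K ≠ -4)
    (hpD : ¬ ((p : ℤ) ∣ NumberField.discr K)) (hspl : SatisfiesHeegnerHypothesis p K)
    [iNZ : NeZero (W.conductorNorm ℤ)] (hH : SatisfiesHeegnerHypothesis (W.conductorNorm ℤ) K)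
    (T : WeierstrassCurve ℚ) [T.IsElliptic] [T.IsGloballyMinimal] (C : WeierstrassCurve.VariableChange ℚ)
    (hC : C • T = W.quadraticTwist (NumberField.discr K : ℚ))
    (hTr : (W.quadraticTwist (NumberField.discr K : ℚ)).analyticRank = 1)
    (k : ℕ) (hk : k + 1 ≤ W.mordellWeilRank)
    (hval : ∀ q : ℚ, T.leadingLCoeff / ((T.realPeriodRat * T.regulator : ℝ) : ℂ) = (q : ℂ) → padicValRat p q ≤ k) :
    ∃ (p : ℕ) (hp : Fact p.Prime), 5 ≤ p ∧ W.HasGoodReductionAtPrime p ∧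
      ¬ (p : ℤ) ∣ W.frobeniusTrace p ∧ (∀ n : ℕ, W.HasSurjectiveModNGaloisRep (p ^ n : ℕ)) ∧
      (∀ v : HeightOneSpectrum (𝓞 ℚ), W.HasMultiplicativeReductionAt v →
        ¬ p ∣ W.ordMinimalDiscriminant v) ∧
      ∃ (K : Type) (_ : Field K) (_ : NumberField K), IsImaginaryQuadratic K ∧
        NumberField.discr K ≠ -3 ∧ NumberField.discr K ≠ -4 ∧
        ∃ (_ : NeZero (W.conductorNorm ℤ)), SatisfiesHeegnerHypothesis (W.conductorNorm ℤ) K ∧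
        ∃ (Dt : ModularParametrizationData W (W.conductorNorm ℤ)) (β : ℤ) (ι : K →+* ℂ) (n₁ : ℕ)
          (d : KolyvaginHeegnerData Dt β ι n₁), Squarefree n₁ ∧
          (∀ q ∈ n₁.primeFactors, Zhang2014.IsKolyvaginPrime (W.conductorNorm ℤ) W K p q) ∧
          d.kolyvaginClass hp.out 1 ≠ 0 ∧
          (n₁.primeFactors.card + 1 ≤ W.mordellWeilRank ∨
            (n₁.primeFactors.card ≤ W.mordellWeilRank ∧
              n₁.primeFactors.card + 1 ≤ (W.quadraticTwist (NumberField.discr K : ℚ)).mordellWeilRank)) := by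
  have hsur : W.HasSurjectiveModNGaloisRep p := by simpa only [pow_one] using htower 1
  have hSel := natCard_selmerGroup_quadraticTwist_le_of_bsdQuotient_intrinsic hBCS hGZK W hcm p h5 hgood hord hsur
    (NumberField.discr_ne_zero K) hpD T C hC hTr k hval
  exact cruxBody_of_twistSelmer_of_steinWuthrich_split hSW h3 hZ hHZ hnf hMaz W hcm hr hN p h5 hp1000 hgood hord htower hKN
    K hK hodd hD3 hD4 hpD hspl hH (hSel.trans (Nat.pow_le_pow_right hp.out.pos hk))

end Summit.BirchSwinnertonDyer.BirchSwinnertonDyer.Theorems.KolyvaginDepthDoor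

end
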